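import Literature.NumberTheory.EllipticCurves.BSDSelmerSmithCases
import HarnessLib

/-!
# Smith's Assumption 1.1 (arXiv:2207.05674, [Smi22a]): the `2`-torsion structures covered by the
# first twist-family theorem

Topic `NumberTheory/EllipticCurves`. One definition (no theorems of substance, no named facts):
the standing hypothesis of A. Smith, *The distribution of `ℓ^∞`-Selmer groups in degree `ℓ` twist
families I*, arXiv:2207.05674 (2022) [Smi22a], §1.1, **Assumption 1.1**, under which its
Thm. 1.2 gives the distribution `1/2, 1/2, 0` of `2^∞`-Selmer coranks in the quadratic twist
family of an elliptic curve `A/ℚ`: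

> *An elliptic curve `A/ℚ` obeys this assumption if one of the following holds:*
> *(1) `A(ℚ)[2] = 0`; or*
> *(2) `A(ℚ)[2] ≅ ℤ/2ℤ` and, writing `φ : A → A_0` for the unique `ℚ`-isogeny of degree `2`, we
> have `ℚ(A_0[2]) ≠ ℚ` and `ℚ(A_0[2]) ≠ ℚ(A[2])`; or*
> *(3) `A(ℚ)[2] ≅ (ℤ/2ℤ)²` and `A` has no cyclic degree `4` isogeny defined over `ℚ`.*

This is the hypothesis behind the input *"If `E` is in Case I or Case II, Theorem 1.1 follows
for `E` from [Smi22a]"* of A. Smith, arXiv:2503.17619 (2025), §1.1 (tree: bsd.S34,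
`smith_selmerCorank_density`; the case split is `smithCaseI`–`smithCaseV`,
`BSDSelmerSmithCases`). That Assumption 1.1 is *equivalent* to "Case I or Case II" of
arXiv:2503.17619, Def. 1.6 — in particular that for a curve with full rational `2`-torsion
"no cyclic degree `4` isogeny over `ℚ`" is the same as "no balanced isogeny" — is a theorem of
the companion file `BSDSelmerSmithAssumptionProofs`, which also restates the assembly of
arXiv:2503.17619, Thm. 1.1 with [Smi22a], Thm. 1.2 as a verbatim hypothesis.

Encodings (the same as in `BSDSelmerSmithCases`, so that the two papers meet on identical
objects):

* `A(ℚ)[2] = 0`, `≅ ℤ/2ℤ`, `≅ (ℤ/2ℤ)²` ⟺ `ratTwoTorsionCard A = 1, 2, 4` (the number of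
  `Γ_ℚ`-fixed points of `A[2] = A(ℚ̄)[2]`).
* `ℚ(A_0[2]) ≠ ℚ` ⟺ `ker ρ̄_{A_0,2} ≠ Γ_ℚ`, and `ℚ(A_0[2]) ≠ ℚ(A[2])` ⟺ `ker ρ̄_{A_0,2} ≠ ker ρ̄_{A,2}`
  (`WeierstrassCurve.galoisRepTorsion · 2`; fixed fields of open normal subgroups of `Γ_ℚ`
  coincide iff the subgroups do).
* "the unique `ℚ`-isogeny of degree `2`" (branch (2)): with `A(ℚ)[2] ≅ ℤ/2ℤ` every degree-`2`
  `ℚ`-isogeny on `A` has kernel `A(ℚ)[2]`, the quotient being unique up to `ℚ`-isomorphism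
  (Silverman, *AEC*, III.4.11–4.12), and both conditions are invariant under `ℚ`-isomorphism of
  `A_0`; the definition quantifies *universally* over degree-`2` isogenies `φ : A → A_0` to
  (models of) elliptic curves, and the `…Proofs` file shows this agrees with the existential
  reading (such an isogeny exists, tree `exists_isogeny_degree_two_of_fixed`).
* "cyclic degree `4` isogeny defined over `ℚ`" ⟺ an isogeny `ψ : A → A''` in the tree's sense
  (`WeierstrassCurve.Isogeny`: `Γ_ℚ`-equivariant, i.e. defined over `ℚ`) to (a model of) an
  elliptic curve over `ℚ`, with cyclic kernel (`Isogeny.IsCyclic`) of order `4`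
  (`Isogeny.degree = #ker`, characteristic `0`).

## References

* [Smith2022SelmerTwistI] A. Smith, *The distribution of `ℓ^∞`-Selmer groups in degree `ℓ` twist
  families I*, arXiv:2207.05674 (2022), §1.1, Assumption 1.1 and Thm. 1.2.
* [arXiv250317619] A. Smith, arXiv:2503.17619 (2025), §1.1, Def. 1.6 and the sentence "If `E` is
  in Case I or Case II, Theorem 1.1 follows for `E` from [Smi22a]".
* [SilvermanAEC2009] J. H. Silverman, *The Arithmetic of Elliptic Curves*, 2nd ed., III.4.11,
  III.4.12, III.§7.
-/

noncomputable section

open scoped Classical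

namespace Literature.NumberTheory.EllipticCurves

open WeierstrassCurve

/-- **Smith's Assumption 1.1** ([Smi22a] = arXiv:2207.05674, §1.1): the elliptic curve `A/ℚ`
satisfies one of
(1) `A(ℚ)[2] = 0`;
(2) `A(ℚ)[2] ≅ ℤ/2ℤ` and, for the (unique up to isomorphism of the target) degree-`2` `ℚ`-isogeny
`φ : A → A_0`, `ℚ(A_0[2]) ≠ ℚ` and `ℚ(A_0[2]) ≠ ℚ(A[2])`;
(3) `A(ℚ)[2] ≅ (ℤ/2ℤ)²` and `A` has no cyclic degree-`4` isogeny defined over `ℚ`.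
Encoded with `#A(ℚ)[2] = ratTwoTorsionCard A`, `ℚ(·[2])` through `ker ρ̄_{·,2}`
(`galoisRepTorsion · 2`), and isogenies/targets in the tree's sense (targets range over
Weierstrass models of elliptic curves over `ℚ`). Under this assumption [Smi22a], Thm. 1.2 gives the
`1/2, 1/2, 0` distribution of `2^∞`-Selmer coranks of the quadratic twists `A^d`.
[cite: Smith2022SelmerTwistI, Assumption 1.1] -/
def smi22aAssumption (W : WeierstrassCurve ℚ) : Prop :=
  ratTwoTorsionCard W = 1 ∨
    (ratTwoTorsionCard W = 2 ∧
      ∀ (W₀ : WeierstrassCurve ℚ) [W₀.IsElliptic] (φ : Isogeny W W₀), φ.degree = 2 →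
        (W₀.galoisRepTorsion 2).ker ≠ ⊤ ∧
          (W₀.galoisRepTorsion 2).ker ≠ (W.galoisRepTorsion 2).ker) ∨
    (ratTwoTorsionCard W = 4 ∧
      ∀ (W'' : WeierstrassCurve ℚ) [W''.IsElliptic] (ψ : Isogeny W W''), ψ.IsCyclic → ψ.degree ≠ 4)

/-- Unfolding `smi22aAssumption`. [cite: Smith2022SelmerTwistI, Assumption 1.1] -/
theorem smi22aAssumption_iff (W : WeierstrassCurve ℚ) :
    smi22aAssumption W ↔
      ratTwoTorsionCard W = 1 ∨
        (ratTwoTorsionCard W = 2 ∧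
          ∀ (W₀ : WeierstrassCurve ℚ) [W₀.IsElliptic] (φ : Isogeny W W₀), φ.degree = 2 →
            (W₀.galoisRepTorsion 2).ker ≠ ⊤ ∧
              (W₀.galoisRepTorsion 2).ker ≠ (W.galoisRepTorsion 2).ker) ∨
        (ratTwoTorsionCard W = 4 ∧
          ∀ (W'' : WeierstrassCurve ℚ) [W''.IsElliptic] (ψ : Isogeny W W''),
            ψ.IsCyclic → ψ.degree ≠ 4) :=
  Iff.rfl

/-- Branch (1) of Assumption 1.1: `A(ℚ)[2] = 0`. [cite: Smith2022SelmerTwistI, Assumption 1.1] -/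
theorem smi22aAssumption_of_ratTwoTorsionCard_eq_one {W : WeierstrassCurve ℚ}
    (h : ratTwoTorsionCard W = 1) : smi22aAssumption W :=
  Or.inl h

/-- Branch (2) of Assumption 1.1: `A(ℚ)[2] ≅ ℤ/2ℤ`, `ℚ(A_0[2]) ≠ ℚ`, `ℚ(A_0[2]) ≠ ℚ(A[2])`.
[cite: Smith2022SelmerTwistI, Assumption 1.1] -/
theorem smi22aAssumption_of_ratTwoTorsionCard_eq_two {W : WeierstrassCurve ℚ}
    (h : ratTwoTorsionCard W = 2)
    (h' : ∀ (W₀ : WeierstrassCurve ℚ) [W₀.IsElliptic] (φ : Isogeny W W₀), φ.degree = 2 →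
      (W₀.galoisRepTorsion 2).ker ≠ ⊤ ∧ (W₀.galoisRepTorsion 2).ker ≠ (W.galoisRepTorsion 2).ker) :
    smi22aAssumption W :=
  Or.inr (Or.inl ⟨h, h'⟩)

/-- Branch (3) of Assumption 1.1: `A(ℚ)[2] ≅ (ℤ/2ℤ)²` and no cyclic degree-`4` isogeny over `ℚ`.
[cite: Smith2022SelmerTwistI, Assumption 1.1] -/
theorem smi22aAssumption_of_ratTwoTorsionCard_eq_four {W : WeierstrassCurve ℚ}
    (h : ratTwoTorsionCard W = 4)
    (h' : ∀ (W'' : WeierstrassCurve ℚ) [W''.IsElliptic] (ψ : Isogeny W W''),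
      ψ.IsCyclic → ψ.degree ≠ 4) :
    smi22aAssumption W :=
  Or.inr (Or.inr ⟨h, h'⟩)

/-- With `#A(ℚ)[2] = 2`, Assumption 1.1 is its branch (2). [cite: Smith2022SelmerTwistI, Assumption 1.1] -/
theorem smi22aAssumption_iff_of_ratTwoTorsionCard_eq_two {W : WeierstrassCurve ℚ}
    (h : ratTwoTorsionCard W = 2) :
    smi22aAssumption W ↔
      ∀ (W₀ : WeierstrassCurve ℚ) [W₀.IsElliptic] (φ : Isogeny W W₀), φ.degree = 2 →
        (W₀.galoisRepTorsion 2).ker ≠ ⊤ ∧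
          (W₀.galoisRepTorsion 2).ker ≠ (W.galoisRepTorsion 2).ker := by
  unfold smi22aAssumption
  constructor
  · rintro (h1 | ⟨-, h2⟩ | ⟨h4, -⟩)
    · omega
    · exact h2
    · omega
  · exact fun h2 ↦ Or.inr (Or.inl ⟨h, h2⟩)

/-- With `#A(ℚ)[2] = 4`, Assumption 1.1 is its branch (3). [cite: Smith2022SelmerTwistI, Assumption 1.1] -/
theorem smi22aAssumption_iff_of_ratTwoTorsionCard_eq_four {W : WeierstrassCurve ℚ}
    (h : ratTwoTorsionCard W = 4) :
    smi22aAssumption W ↔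
      ∀ (W'' : WeierstrassCurve ℚ) [W''.IsElliptic] (ψ : Isogeny W W''),
        ψ.IsCyclic → ψ.degree ≠ 4 := by
  unfold smi22aAssumption
  constructor
  · rintro (h1 | ⟨h2, -⟩ | ⟨-, h3⟩)
    · omega
    · omega
    · exact h3
  · exact fun h3 ↦ Or.inr (Or.inr ⟨h, h3⟩)

end Literature.NumberTheory.EllipticCurves

end
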